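import Literature.Computability.AlgebraicComplexity.PerDetObstructionKinds
import Literature.Computability.AlgebraicComplexity.HwvIdealRankBound
import HarnessLib

/-!
# Exact orbit-closure multiplicities pinned by evaluation certificates (det versus padded per)

Topic `Literature/Computability/AlgebraicComplexity`; companion of `PerDetObstructionKinds.lean`
(which KIND of obstruction a certificate establishes) and `HwvIdealRankBound.lean` (rank–nullity
`mult_χ k[Δ_m[f]] + dim (HWV_χ ∩ I(GL·f)) = a_χ`). Honest framing of the cell these shapes serve
(`pub-gct`, papers/PneNP/gct-obstructions): rung-1 multiplicity-obstruction search for permanent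
versus determinant at small `(n, m)`; no claim about VP ≠ VNP or P ≠ NP.

An evaluation certificate gives LOWER bounds only: a nonsingular `r × r` matrix of values of
weight-`χ` highest-weight vectors at points of an orbit closure proves `r ≤ mult_χ`
(`HwvEvaluationRankBound.lean`; Dörfler–Ikenmeyer–Panova 2020 §5; Cheung–Ikenmeyer–Mkrtchyan 2017
§1: evaluation ranks bound closure multiplicities from below). Two printed UPPER bounds close the
sandwich in favourable cases, and then the certificate determines a multiplicity EXACTLY:

* permanent side: `mult_χ k[Δ(X₀₀^{m-n} per_n)] ≤ a_χ` (the ambient/plethysm multiplicity, BLMW 2011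
  §4.4; tree `orbitMultiplicity_le_plethysmCoeff_holds`), so a certificate with `a_χ ≤ r` pins
  `mult = a_χ` and — by rank–nullity — shows that NO nonzero weight-`χ` highest-weight vector of
  `k[Sym^m (k^{m²})]` vanishes on the orbit `GL_{m²} · X₀₀^{m-n} per_n` ("`Δ(X₀₀^{m-n} per_n)` has no
  equation of type `χ`");
* determinant side: `mult_{λ*} k[Δ(det_m)] ≤ sk(λ, m × d)` (BLMW 2011 Prop. 5.2.1 (5.2.7); tree
  `orbitMultiplicity_det_le_symKroneckerCoeffRect`), so a det-side certificate with `sk ≤ r'` pins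
  `mult = sk` and the number of linearly independent weight-`λ*` highest-weight EQUATIONS of
  `Δ(det_m)` in degree `d` is exactly `a - sk` (Bürgisser–Ikenmeyer 2013 (5.1)–(5.2) give `≥ a - sk`
  in general).

The only printed exact closure multiplicity for `Δ(det_3)` beyond the equation-free range is
Landsberg–Manivel–Ressayre 2013 §3.2 (type `(19,7,2⁵)`, degree 12: ambient 6, one copy in the
ideal); exact values of this kind for other `(λ, d)` and for `Δ(per_3)` are what the shapes below
let a certificate table assert.  All statements are elementary consequences of the cited tree
theorems; no definitions, no named facts.

## References

* P. Bürgisser, J. M. Landsberg, L. Manivel, J. Weyman, *An overview of mathematical issues arising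
  in the geometric complexity theory approach to VP ≠ VNP*, SIAM J. Comput. 40 (2011) =
  arXiv:0907.2850v3, §4.4 and §5.2 Prop. 5.2.1 (5.2.7). [BLMW2011]
* P. Bürgisser, C. Ikenmeyer, *Explicit lower bounds via geometric complexity theory*, STOC 2013 =
  arXiv:1210.8368, §5 (5.1)–(5.2). [BurgisserIkenmeyer2013]
* J. Dörfler, C. Ikenmeyer, G. Panova, *On geometric complexity theory: Multiplicity obstructions
  are stronger than occurrence obstructions*, SIAM J. Appl. Algebra Geom. 4 (2020) =
  arXiv:1901.04576, §2 (2.2) and §5. [DorflerIkenmeyerPanova2020]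
* J. M. Landsberg, L. Manivel, N. Ressayre, *Hypersurfaces with degenerate duals and the geometric
  complexity theory program*, Comment. Math. Helv. 88 (2013) 469–484, §3.2 p. 476. [LandsbergManivelRessayre2013]

## Mathlib and tree

Tree: `orbitMultiplicity_le_plethysmCoeff_holds` (`MultiplicityObstructionsProofs.lean`),
`orbitMultiplicity_det_le_symKroneckerCoeffRect` (`DetOrbitSymKroneckerBound.lean`),
`orbitMultiplicity_add_finrank_inf_eq_plethysmCoeff`,
`orbitMultiplicity_add_le_plethysmCoeff_of_linearIndependent` (`HwvIdealRankBound.lean`),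
`paddedPerFormLex_isHomogeneous`, `detFormLex_isHomogeneous` (`SchurWeylPlethysm.lean`),
`IsMultiplicityObstructionAt` (`ObstructionTypes.lean`).
-/

noncomputable section

namespace Literature.Computability.AlgebraicComplexity

open _root_.Literature.NumberTheory.DiophantineGeometry

variable {k : Type} [Field k]

/-! ### 1. Permanent side: a certificate reaching the ambient multiplicity -/

/-- **Permanent-side multiplicity pinned at the ambient value.** If `n ≤ m` and a rank certificate
reaches the ambient (plethysm) multiplicity, `a_χ ≤ mult_χ k[Δ(X₀₀^{m-n} per_n)]` (e.g. `a_χ ≤ r ≤ mult`),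
then `mult_χ k[Δ(X₀₀^{m-n} per_n)] = a_χ` (upper bound BLMW 2011 §4.4). [cite: BLMW2011, §4.4] -/
theorem orbitMultiplicity_paddedPer_eq_plethysmCoeff_of_le [CharZero k] {n m : ℕ} [NeZero m]
    (hnm : n ≤ m) {χ : Weight (MatIdx m)}
    (hper : plethysmCoeff k (MatIdx m) m χ ≤ orbitMultiplicity k (paddedPerFormLex k n m) m χ) :
    orbitMultiplicity k (paddedPerFormLex k n m) m χ = plethysmCoeff k (MatIdx m) m χ :=
  le_antisymm (orbitMultiplicity_le_plethysmCoeff_holds (k := k) (paddedPerFormLex k n m)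
    (NeZero.ne m) (paddedPerFormLex_isHomogeneous (k := k) hnm) χ) hper

/-- **No equation of type `χ` for the padded permanent.** Under the same hypothesis the space of
weight-`χ` highest-weight vectors of `k[Sym^m (k^{m²})]` lying in the vanishing ideal of the orbit
`GL_{m²} · X₀₀^{m-n} per_n` is zero-dimensional (rank–nullity, DIP20 (2.2)/§5).
[cite: DorflerIkenmeyerPanova2020, §5] -/
theorem finrank_hwv_inf_orbitVanishingIdeal_paddedPer_eq_zero_of_le [CharZero k] {n m : ℕ}
    [NeZero m] (hnm : n ≤ m) {χ : Weight (MatIdx m)}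
    (hper : plethysmCoeff k (MatIdx m) m χ ≤ orbitMultiplicity k (paddedPerFormLex k n m) m χ) :
    Module.finrank k ↥(highestWeightSpace (coordRep (MatIdx m) k m) χ ⊓
        (orbitVanishingIdeal (paddedPerFormLex k n m) m).restrictScalars k) = 0 := by
  have h := orbitMultiplicity_add_finrank_inf_eq_plethysmCoeff (k := k) (paddedPerFormLex k n m)
    (NeZero.ne m) χ
  rw [orbitMultiplicity_paddedPer_eq_plethysmCoeff_of_le (k := k) hnm hper] at h
  omega

/-- **Pointwise form**: every weight-`χ` highest-weight vector of `k[Sym^m (k^{m²})]` that vanishes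
on the orbit `GL_{m²} · X₀₀^{m-n} per_n` is zero, as soon as a certificate gives
`a_χ ≤ mult_χ k[Δ(X₀₀^{m-n} per_n)]` (one independent equation would force `mult + 1 ≤ a_χ`,
Bürgisser–Ikenmeyer 2013 (5.2) / DIP20 §5). [cite: DorflerIkenmeyerPanova2020, §5] -/
theorem eq_zero_of_mem_hwv_of_mem_orbitVanishingIdeal_paddedPer [CharZero k] {n m : ℕ} [NeZero m]
    (hnm : n ≤ m) {χ : Weight (MatIdx m)}
    (hper : plethysmCoeff k (MatIdx m) m χ ≤ orbitMultiplicity k (paddedPerFormLex k n m) m χ)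
    {F : MvPolynomial (DegIdx (MatIdx m) m) k}
    (hF : F ∈ highestWeightSpace (coordRep (MatIdx m) k m) χ)
    (hI : F ∈ orbitVanishingIdeal (paddedPerFormLex k n m) m) : F = 0 := by
  by_contra hne
  have hli : LinearIndependent k ![F] := by
    rw [linearIndependent_unique_iff]
    simpa using hne
  have h := orbitMultiplicity_add_le_plethysmCoeff_of_linearIndependent (k := k)
    (f := paddedPerFormLex k n m) (NeZero.ne m) (χ := χ) ![F] (fun _ => by simpa using hF)
    (fun _ => by simpa using hI) hli
  have heq := orbitMultiplicity_paddedPer_eq_plethysmCoeff_of_le (k := k) hnm hper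
  omega

/-! ### 2. Determinant side: a certificate reaching the symmetric Kronecker coefficient -/

/-- **Determinant-side multiplicity pinned at `sk`.** If `ℓ(λ) ≤ m²` and a det-side rank
certificate reaches BLMW's bound, `sk(λ, m × d) ≤ mult_{λ*} k[Δ(det_m)]` (e.g. `sk ≤ r' ≤ mult`), then
`mult_{λ*} k[Δ(det_m)] = sk(λ, m × d)` exactly (upper bound BLMW 2011 Prop. 5.2.1 (5.2.7)).
[cite: BLMW2011, §5.2 Prop. 5.2.1] -/
theorem orbitMultiplicity_det_eq_symKroneckerCoeffRect_of_le [CharZero k] {m d : ℕ}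
    {lam : Nat.Partition (m * d)} (hlam : lam.parts.card ≤ m * m)
    (hdet : symKroneckerCoeffRect k m d lam ≤
      orbitMultiplicity k (detFormLex k m) m (Weight.dualOfPartition (m * m) lam).toMatIdx) :
    orbitMultiplicity k (detFormLex k m) m (Weight.dualOfPartition (m * m) lam).toMatIdx =
      symKroneckerCoeffRect k m d lam :=
  le_antisymm (orbitMultiplicity_det_le_symKroneckerCoeffRect k m lam hlam) hdet

/-- **Exact number of independent highest-weight equations of `Δ(det_m)`.** If `m ≠ 0`,
`ℓ(λ) ≤ m²` and `sk(λ, m × d) ≤ mult_{λ*} k[Δ(det_m)]`, then the weight-`λ*` highest-weight vectors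
of `k[Sym^m (k^{m²})]` lying in the vanishing ideal of `GL_{m²} · det_m` form a space of dimension
exactly `a_{λ*} - sk(λ, m × d)` (stated additively): Bürgisser–Ikenmeyer 2013 (5.1)–(5.2) give
`≥ a - sk` for every `λ`; the certificate makes it an equality. [cite: BurgisserIkenmeyer2013, §5 (5.2)] -/
theorem finrank_hwv_inf_orbitVanishingIdeal_det_add_eq_plethysmCoeff [CharZero k] {m d : ℕ}
    [NeZero m] {lam : Nat.Partition (m * d)} (hlam : lam.parts.card ≤ m * m)
    (hdet : symKroneckerCoeffRect k m d lam ≤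
      orbitMultiplicity k (detFormLex k m) m (Weight.dualOfPartition (m * m) lam).toMatIdx) :
    Module.finrank k ↥(highestWeightSpace (coordRep (MatIdx m) k m)
          (Weight.dualOfPartition (m * m) lam).toMatIdx ⊓
        (orbitVanishingIdeal (detFormLex k m) m).restrictScalars k) +
        symKroneckerCoeffRect k m d lam =
      plethysmCoeff k (MatIdx m) m (Weight.dualOfPartition (m * m) lam).toMatIdx := by
  have h := orbitMultiplicity_add_finrank_inf_eq_plethysmCoeff (k := k) (detFormLex k m)
    (NeZero.ne m) ((Weight.dualOfPartition (m * m) lam).toMatIdx : Weight (MatIdx m))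
  rw [orbitMultiplicity_det_eq_symKroneckerCoeffRect_of_le (k := k) hlam hdet] at h
  omega

/-! ### 3. Both pins: the exact multiplicity gap of a certified row -/

/-- **Exact gap.** With `n ≤ m`, `ℓ(λ) ≤ m²`, a permanent-side certificate reaching `a` and a
det-side certificate reaching `sk`, both closure multiplicities are determined:
`mult_{λ*} k[Δ(X₀₀^{m-n} per_n)] = a` and `mult_{λ*} k[Δ(det_m)] = sk`; if moreover `sk < a` the row is
a multiplicity obstruction with gap exactly `a - sk` (DIP20 §2: "a multiplicity obstruction … if
additionally `mult = 0` … an occurrence obstruction"; here `mult_det = sk` decides which).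
[cite: DorflerIkenmeyerPanova2020, §2] -/
theorem orbitMultiplicity_perDet_eq_of_pins [CharZero k] {n m d : ℕ} [NeZero m] (hnm : n ≤ m)
    {lam : Nat.Partition (m * d)} (hlam : lam.parts.card ≤ m * m)
    (hper : plethysmCoeff k (MatIdx m) m (Weight.dualOfPartition (m * m) lam).toMatIdx ≤
      orbitMultiplicity k (paddedPerFormLex k n m) m (Weight.dualOfPartition (m * m) lam).toMatIdx)
    (hdet : symKroneckerCoeffRect k m d lam ≤
      orbitMultiplicity k (detFormLex k m) m (Weight.dualOfPartition (m * m) lam).toMatIdx) :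
    orbitMultiplicity k (paddedPerFormLex k n m) m (Weight.dualOfPartition (m * m) lam).toMatIdx =
        plethysmCoeff k (MatIdx m) m (Weight.dualOfPartition (m * m) lam).toMatIdx ∧
      orbitMultiplicity k (detFormLex k m) m (Weight.dualOfPartition (m * m) lam).toMatIdx =
        symKroneckerCoeffRect k m d lam :=
  ⟨orbitMultiplicity_paddedPer_eq_plethysmCoeff_of_le (k := k) hnm hper,
    orbitMultiplicity_det_eq_symKroneckerCoeffRect_of_le (k := k) hlam hdet⟩

/-- **Exact gap, obstruction form**: under both pins and `sk < a` the weight `λ*` is a multiplicity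
obstruction with `mult_per = mult_det + (a - sk)`. [cite: DorflerIkenmeyerPanova2020, §2] -/
theorem isMultiplicityObstructionAt_of_pins [CharZero k] {n m d : ℕ} [NeZero m] (hnm : n ≤ m)
    {lam : Nat.Partition (m * d)} (hlam : lam.parts.card ≤ m * m)
    (hsk : symKroneckerCoeffRect k m d lam <
      plethysmCoeff k (MatIdx m) m (Weight.dualOfPartition (m * m) lam).toMatIdx)
    (hper : plethysmCoeff k (MatIdx m) m (Weight.dualOfPartition (m * m) lam).toMatIdx ≤
      orbitMultiplicity k (paddedPerFormLex k n m) m (Weight.dualOfPartition (m * m) lam).toMatIdx)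
    (hdet : symKroneckerCoeffRect k m d lam ≤
      orbitMultiplicity k (detFormLex k m) m (Weight.dualOfPartition (m * m) lam).toMatIdx) :
    IsMultiplicityObstructionAt (detFormLex k m) (paddedPerFormLex k n m) m
        (Weight.dualOfPartition (m * m) lam).toMatIdx ∧
      orbitMultiplicity k (paddedPerFormLex k n m) m (Weight.dualOfPartition (m * m) lam).toMatIdx =
        orbitMultiplicity k (detFormLex k m) m (Weight.dualOfPartition (m * m) lam).toMatIdx +
          (plethysmCoeff k (MatIdx m) m (Weight.dualOfPartition (m * m) lam).toMatIdx -
            symKroneckerCoeffRect k m d lam) := by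
  obtain ⟨hp, hd⟩ := orbitMultiplicity_perDet_eq_of_pins (k := k) hnm hlam hper hdet
  unfold IsMultiplicityObstructionAt
  omega

/-! ### 4. Any form: an evaluation certificate reaching the ambient multiplicity ("no equation")

The permanent-side statements of §1 only use `mult ≤ a` (BLMW 2011 §4.4), which holds for every
homogeneous form. Stated once in that generality they serve the det side too: a det-side rank
certificate with `a ≤ r'` (possible only when `a ≤ sk`) shows that `Δ(det_m)` has NO equation of the
given type and degree — the cell shape of the statement "`I(Δ(det_3))_d = 0`" degree by degree
(Tranche 1c of the cell; print status: the least degree of a nonzero element of `I(Δ(det_3))` is not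
stated in the literature searched; `≤ 10` follows from Ikenmeyer 2012 App. A.1 with
Bürgisser–Ikenmeyer 2013 (5.2)). -/

section AnyForm

variable {σ : Type} [Fintype σ] [LinearOrder σ]

/-- **Multiplicity pinned at the ambient value, any form.** For a homogeneous form `f` of degree
`m ≠ 0` and a weight `χ`: `a_χ ≤ mult_χ k[Δ_m[f]]` (e.g. from a rank certificate at points of the orbit
closure) forces `mult_χ k[Δ_m[f]] = a_χ` (BLMW 2011 §4.4: `mult ≤ a`). [cite: BLMW2011, §4.4] -/
theorem orbitMultiplicity_eq_plethysmCoeff_of_le [CharZero k] {f : MvPolynomial σ k} {m : ℕ}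
    (hm : m ≠ 0) (hf : f.IsHomogeneous m) {χ : Weight σ}
    (hle : plethysmCoeff k σ m χ ≤ orbitMultiplicity k f m χ) :
    orbitMultiplicity k f m χ = plethysmCoeff k σ m χ :=
  le_antisymm (orbitMultiplicity_le_plethysmCoeff_holds (k := k) f hm hf χ) hle

/-- **No equation of type `χ`, any form** (dimension form): under the same hypothesis the
weight-`χ` highest-weight vectors of `k[Sym^m (k^σ)]` lying in the vanishing ideal of `GL · f` form
the zero subspace (rank–nullity, DIP20 (2.2)/§5). [cite: DorflerIkenmeyerPanova2020, §5] -/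
theorem finrank_hwv_inf_orbitVanishingIdeal_eq_zero_of_le [CharZero k] {f : MvPolynomial σ k}
    {m : ℕ} (hm : m ≠ 0) (hf : f.IsHomogeneous m) {χ : Weight σ}
    (hle : plethysmCoeff k σ m χ ≤ orbitMultiplicity k f m χ) :
    Module.finrank k ↥(highestWeightSpace (coordRep σ k m) χ ⊓
        (orbitVanishingIdeal f m).restrictScalars k) = 0 := by
  have h := orbitMultiplicity_add_finrank_inf_eq_plethysmCoeff (k := k) f hm χ
  rw [orbitMultiplicity_eq_plethysmCoeff_of_le (k := k) hm hf hle] at h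
  omega

/-- **No equation of type `χ`, any form** (pointwise form): every weight-`χ` highest-weight vector
of `k[Sym^m (k^σ)]` vanishing on `GL · f` is zero, as soon as `a_χ ≤ mult_χ k[Δ_m[f]]`
(Bürgisser–Ikenmeyer 2013 (5.2): one independent equation forces `mult + 1 ≤ a`).
[cite: BurgisserIkenmeyer2013, §5 (5.2)] -/
theorem eq_zero_of_mem_hwv_of_mem_orbitVanishingIdeal_of_le [CharZero k] {f : MvPolynomial σ k}
    {m : ℕ} (hm : m ≠ 0) (hf : f.IsHomogeneous m) {χ : Weight σ}
    (hle : plethysmCoeff k σ m χ ≤ orbitMultiplicity k f m χ)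
    {F : MvPolynomial (DegIdx σ m) k} (hF : F ∈ highestWeightSpace (coordRep σ k m) χ)
    (hI : F ∈ orbitVanishingIdeal f m) : F = 0 := by
  by_contra hne
  have hli : LinearIndependent k ![F] := by
    rw [linearIndependent_unique_iff]
    simpa using hne
  have h := orbitMultiplicity_add_le_plethysmCoeff_of_linearIndependent (k := k) (f := f) hm
    (χ := χ) ![F] (fun _ => by simpa using hF) (fun _ => by simpa using hI) hli
  have heq := orbitMultiplicity_eq_plethysmCoeff_of_le (k := k) hm hf hle
  omega

end AnyForm

/-! ### 5. Determinant side reaching the ambient multiplicity: `Δ(det_m)` has no equation of that type -/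

/-- **`Δ(det_m)` pinned at the ambient value.** If a det-side rank certificate reaches the
plethysm multiplicity, `a_χ ≤ mult_χ k[Δ(det_m)]` (`m ≠ 0`), then `mult_χ k[Δ(det_m)] = a_χ`: the
orbit closure of the determinant imposes no equation of type `χ` in that degree. With
`χ = λ*`, `λ ⊢ m d`, this is the per-degree shape of "`I(Δ(det_m))_d` has no component of type `λ*`".
[cite: BLMW2011, §4.4] -/
theorem orbitMultiplicity_det_eq_plethysmCoeff_of_le [CharZero k] {m : ℕ} [NeZero m]
    {χ : Weight (MatIdx m)}
    (hle : plethysmCoeff k (MatIdx m) m χ ≤ orbitMultiplicity k (detFormLex k m) m χ) :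
    orbitMultiplicity k (detFormLex k m) m χ = plethysmCoeff k (MatIdx m) m χ :=
  orbitMultiplicity_eq_plethysmCoeff_of_le (k := k) (NeZero.ne m) (detFormLex_isHomogeneous k m) hle

/-- **No highest-weight equation of `Δ(det_m)` of type `χ`**: under `a_χ ≤ mult_χ k[Δ(det_m)]`, every
weight-`χ` highest-weight vector of `k[Sym^m (k^{m²})]` that vanishes on `GL_{m²} · det_m` is zero.
[cite: BurgisserIkenmeyer2013, §5 (5.2)] -/
theorem eq_zero_of_mem_hwv_of_mem_orbitVanishingIdeal_det [CharZero k] {m : ℕ} [NeZero m]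
    {χ : Weight (MatIdx m)}
    (hle : plethysmCoeff k (MatIdx m) m χ ≤ orbitMultiplicity k (detFormLex k m) m χ)
    {F : MvPolynomial (DegIdx (MatIdx m) m) k}
    (hF : F ∈ highestWeightSpace (coordRep (MatIdx m) k m) χ)
    (hI : F ∈ orbitVanishingIdeal (detFormLex k m) m) : F = 0 :=
  eq_zero_of_mem_hwv_of_mem_orbitVanishingIdeal_of_le (k := k) (NeZero.ne m)
    (detFormLex_isHomogeneous k m) hle hF hI

/-- In particular such a `χ = λ*` is NOT a multiplicity obstruction against `X₀₀^{m-n} per_n ∈ Δ(det_m)`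
(`n ≤ m`): the det side already attains the common upper bound `a`. [cite: BLMW2011, §4.4] -/
theorem not_isMultiplicityObstructionAt_perDet_of_det_plethysmCoeff_le [CharZero k] {n m : ℕ}
    [NeZero m] (hnm : n ≤ m) {χ : Weight (MatIdx m)}
    (hle : plethysmCoeff k (MatIdx m) m χ ≤ orbitMultiplicity k (detFormLex k m) m χ) :
    ¬ IsMultiplicityObstructionAt (detFormLex k m) (paddedPerFormLex k n m) m χ := by
  have hper := orbitMultiplicity_le_plethysmCoeff_holds (k := k) (paddedPerFormLex k n m)
    (NeZero.ne m) (paddedPerFormLex_isHomogeneous (k := k) hnm) χ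
  unfold IsMultiplicityObstructionAt
  omega

end Literature.Computability.AlgebraicComplexity
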